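import Literature.Computation.KummerOrbifold.Bases
import Literature.Computation.Sparse.SparseFinsupp
import HarnessLib

/-!
# Kummer orbifold model — the global index layout and the COLUMN functions of the model operators

Area `Literature/Computation/KummerOrbifold` (cell `hodge-kum4`, seat p1).  RAW INDICES: the reduced
monomials of every (class representative, internal degree), laid out contiguously degree by degree
(`Layout`: `offK k + boff(block) + rank(mask)`), plus, for the point sector `P = [m]` (whose fixed
locus is the `m⁴` points `A[m]`), `m⁴` separate POINT indices in degree `2(m-1)` — the sector unit is
their sum (`encodeExt` spreads it), so that the translation group `A[m]` acts on the model by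
permuting the point indices and fixing all others.  COLUMN FUNCTIONS `ℕ → SpVec` (sparse vectors of
`Computation/Sparse/SparseFinsupp`): `colWedgeFast`/`wedgeTable` (multiplication by an untwisted class,
in particular `L_{ω₀}`), `colLamFast`/`lamTable` (`Λ₀`), `colUntwFast` (untwisted generators),
`colTwFast` (twisted generators, e.g. `δ`: the linear extension of `Y ↦ reduce(X ⋆ extend Y)` evaluated
at one monomial; at a point index `(1/m⁴)·(X ⋆ unit)`, forced by `A[m]`-equivariance since the target
sectors are connected).  The corresponding LINEAR operators are `colOp K col` of `SparseFinsupp`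
(`δ_i ↦ col i`); this file only produces the columns.  Definitions only.

Sources: as `Sectors` (Fu–Tian–Vial 2019 Thm. 1.5; Fantechi–Göttsche 2003 §3); dual Lefschetz
operators: Looijenga–Lunts 1997 §1.
-/

set_option autoImplicit false

namespace Literature.Computation.KummerOrbifold

open Literature.Computation.Sparse

namespace Model
variable (Mo : Model)



/-- a block of raw indices: rep position, internal degree, local offset within the degree, masks
(local → mask) and ranks (mask → local); `npts` is unused (`0`) in the invariant layout.
[cite: FuTianVial2019, Thm. 1.5 (and Thm. 1.4; the orbifold product of §2 with discrete torsion)] -/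
structure IdxBlock where
  ri : Nat
  d : Nat
  boff : Nat
  masks : Array Nat
  rank : Std.HashMap Nat Nat
  npts : Nat      -- 0 unless this is the point block
  deriving Inhabited

/-- `Layout` (data of the computable orbifold model). [cite: FuTianVial2019, Thm. 1.5 (and Thm. 1.4; the orbifold product of §2 with discrete torsion)] -/
structure Layout where
  offK : Array Nat                 -- offset of degree k
  sizeK : Array Nat                -- number of indices of degree k
  blocks : Array (Array IdxBlock)  -- per degree
  blockOfRep : Array (Array (Option Nat))  -- per degree k, per rep position: index into blocks[k]
  ptRep : Nat                      -- rep position of the point sector (l = 1), if any (else reps.size)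
  deriving Inhabited

/-- The raw index layout of the invariant model: for each total degree `k`, the blocks (class rep,
internal degree `k - shift`) with their reduced monomials. [cite: FuTianVial2019, Thm. 1.5 (and Thm. 1.4; the orbifold product of §2 with discrete torsion)] -/
def buildLayout : Layout := Id.run do
  let top := 4 * (Mo.m - 1)
  let nreps := Mo.reps.size
  let mut offK : Array Nat := #[]
  let mut sizeK : Array Nat := #[]
  let mut blocks : Array (Array IdxBlock) := #[]
  let mut blockOfRep : Array (Array (Option Nat)) := #[]
  -- the point sector `P = [m]` is treated like every other sector here (one index for its unit; the
  -- `m⁴` individual points are NOT separate indices in this layout: the model is the A[m]-INVARIANT ring)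
  let ptRep := nreps
  let mut off := 0
  for k in [0:top + 1] do
    let mut bl : Array IdxBlock := #[]
    let mut bor : Array (Option Nat) := Array.replicate nreps none
    let mut boff := 0
    for ri in [0:nreps] do
      let sec := Mo.sec[Mo.reps[ri]!]!
      let sh := sec.shift
      if sh ≤ k then
        let d := k - sh
        if ri == ptRep then
          if d == 0 then
            let npts := Mo.m ^ 4
            bl := bl.push { ri := ri, d := 0, boff := boff, masks := #[], rank := Std.HashMap.emptyWithCapacity 1, npts := npts }
            bor := bor.set! ri (some (bl.size - 1))
            boff := boff + npts
        else
          let keptBits : List Nat := sec.kept.toList.flatMap (fun j => (List.range 4).map (fun a => 4 * j + a))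
          if d ≤ keptBits.length then
            let masks := ((combMasks keptBits d).toArray).qsort (· < ·)
            let mut rank : Std.HashMap Nat Nat := Std.HashMap.emptyWithCapacity (2 * masks.size + 1)
            for t in [0:masks.size] do rank := rank.insert masks[t]! t
            bl := bl.push { ri := ri, d := d, boff := boff, masks := masks, rank := rank, npts := 0 }
            bor := bor.set! ri (some (bl.size - 1))
            boff := boff + masks.size
    offK := offK.push off
    sizeK := sizeK.push boff
    blocks := blocks.push bl
    blockOfRep := blockOfRep.push bor
    off := off + boff
  return { offK := offK, sizeK := sizeK, blocks := blocks, blockOfRep := blockOfRep, ptRep := ptRep }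

/-- global index of the reduced monomial `mask` at rep position `ri` (total degree determined) [folklore] -/
def gIdx (L : Layout) (ri : Nat) (mask : Nat) : Nat :=
  let k := Ext.popcount mask + Mo.sec[Mo.reps[ri]!]!.shift
  match (L.blockOfRep[k]!)[ri]! with
  | none => 0
  | some b => let blk := (L.blocks[k]!)[b]!; L.offK[k]! + blk.boff + blk.rank.getD mask 0

/-- decode a global index: (degree, rep position, mask) or a point (mask := 2^32 + y) [folklore] -/
def Layout.decode (L : Layout) (i : Nat) : Nat × Nat × Nat := Id.run do
  -- find degree
  let mut k := 0
  for kk in [0:L.offK.size] do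
    if L.offK[kk]! ≤ i then k := kk
  let loc := i - L.offK[k]!
  let bl := L.blocks[k]!
  let mut b := 0
  for bb in [0:bl.size] do
    if (bl[bb]!).boff ≤ loc then b := bb
  let blk := bl[b]!
  let t := loc - blk.boff
  if blk.npts > 0 then return (k, blk.ri, 2^32 + t) else return (k, blk.ri, blk.masks.getD t 0)

/-- convert a reduced rep-dict component (rep position `ri`) to global sparse entries; the point
sector's unit coefficient is spread over all points [cite: FuTianVial2019, Thm. 1.5 (and Thm. 1.4; the orbifold product of §2 with discrete torsion)] -/
def encodeExt (L : Layout) (ri : Nat) (x : Ext) : SpVec :=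
  x.fold (fun (acc : SpVec) msk c =>
    if ri == L.ptRep then
      -- unit of the point sector: all points
      let k := Mo.sec[Mo.reps[ri]!]!.shift
      match (L.blockOfRep[k]!)[ri]! with
      | none => acc
      | some b =>
        let blk := (L.blocks[k]!)[b]!
        (List.range blk.npts).foldl (fun (acc : SpVec) y => (L.offK[k]! + blk.boff + y, c) :: acc) acc
    else (Mo.gIdx L ri msk, c) :: acc) []

/-- encode a reduced rep-dict [cite: FuTianVial2019, Thm. 1.5 (and Thm. 1.4; the orbifold product of §2 with discrete torsion)] -/
def encodeCls (L : Layout) (Y : Cls) : SpVec :=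
  Y.fold (fun (acc : SpVec) r y => acc ++ Mo.encodeExt L (Mo.repPos r) (Mo.sec[r]!.reduce y)) []


/-! ## Fast column kernels -/



/-- target-block encoder: global base index and rank map of the block (rep `ri`, total degree `k`) [folklore] -/
def blockEnc (L : Layout) (k ri : Nat) : Option (Nat × Std.HashMap Nat Nat) :=
  if k ≥ L.blocks.size then none else
  match (L.blockOfRep[k]!)[ri]! with
  | none => none
  | some b => let blk := (L.blocks[k]!)[b]!; some (L.offK[k]! + blk.boff, blk.rank)

/-- fast column of "wedge with the fixed reduced form `X` (array of (mask, coeff)) in sector `ri`",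
landing in total degree `k'`; for the point block of the source nothing (handled by caller) [cite: FantechiGoettsche2003, §3 (Thm. 3.10, the ring structure; genus/obstruction rule)] -/
def colWedgeFast (L : Layout) (X : Array (Nat × Rat)) (ri k' mask : Nat) : SpVec :=
  match blockEnc L k' ri with
  | none => []
  | some (base, rank) =>
    X.foldl (fun (acc : SpVec) (t, a) =>
      if t &&& mask != 0 then acc else
        let nm := t ||| mask
        match rank.get? nm with
        | none => acc
        | some loc => (base + loc, if signNegTM t mask then -a else a) :: acc) []

/-- fast Λ₀ column at a monomial of sector `ri` (kept bits `kb`, inverse matrix `Gi` as rows), landing in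
degree `k - 2`: `-½ Σ_i ι_{φ_i} ι_{kb_i} e_mask` [cite: LooijengaLunts1997, §1 p. 4 (the dual Lefschetz operator f_a)] -/
def colLamFast (L : Layout) (kb : Array Nat) (Gi : Array (Array Rat)) (ri k mask : Nat) : SpVec :=
  if k < 2 then [] else
  match blockEnc L (k - 2) ri with
  | none => []
  | some (base, rank) => Id.run do
    let N := kb.size
    -- accumulate into a small hashmap keyed by result mask
    let mut acc : Std.HashMap Nat Rat := Std.HashMap.emptyWithCapacity 32
    for i in [0:N] do
      let bi := kb[i]!
      let bmi := 1 <<< bi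
      if mask &&& bmi != 0 then
        -- ι_{b_i} e_mask = (-1)^{#bits of mask below b_i} e_{mask \ b_i}
        let s1 := pop32 (mask &&& (bmi - 1))
        let m1 := mask ^^^ bmi
        let row := Gi[i]!
        for j in [0:N] do
          if j != i then
            let g := row[j]!
            if g != 0 then
              let bj := kb[j]!
              let bmj := 1 <<< bj
              if m1 &&& bmj != 0 then
                let s2 := pop32 (m1 &&& (bmj - 1))
                let m2 := m1 ^^^ bmj
                let coef : Rat := if (s1 + s2) % 2 == 0 then g else -g
                acc := acc.insert m2 (acc.getD m2 0 + coef)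
    let mut out : SpVec := []
    for (m2, c) in acc.toList do
      if c != 0 then
        match rank.get? m2 with
        | none => pure ()
        | some loc => out := (base + loc, c * ((-1 : Rat) / 2)) :: out
    return out

/-- tables for Λ₀ and `L_{ω₀}` over ALL global indices (fast kernels) [cite: LooijengaLunts1997, §1 p. 4 (the dual Lefschetz operator f_a)] -/
def lamTable (L : Layout) : Array SpVec := Id.run do
  let Ntot := L.offK[L.offK.size - 1]! + L.sizeK[L.sizeK.size - 1]!
  -- per rep: kept bits and Gi (recomputed as in lamData but keeping the matrix)
  let dat : Array (Option (Array Nat × Array (Array Rat))) := Mo.reps.map (fun r =>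
    let sec := Mo.sec[r]!
    if sec.P.size == 1 then none else
    let Om := sec.reduce (restrictTo Mo.om0 sec)
    let keptBits : Array Nat := sec.kept.foldl (fun acc j => acc ++ (Array.range 4).map (fun a => 4 * j + a)) #[]
    let N := keptBits.size
    let pos (b : Nat) : Nat := ((Array.range N).filter (fun i => keptBits[i]! == b))[0]!
    let G0 : Array (Array Rat) := Array.replicate N (Array.replicate N 0)
    let G := Om.fold (fun (G : Array (Array Rat)) msk c =>
      let bs := Ext.bits msk
      let i := pos bs[0]!
      let j := pos bs[1]!
      let G := G.set! i ((G[i]!).set! j ((G[i]!)[j]! + c))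
      G.set! j ((G[j]!).set! i ((G[j]!)[i]! - c))) G0
    some (keptBits, matInv G))
  let mut out : Array SpVec := Array.replicate Ntot []
  for k in [0:L.blocks.size] do
    for blk in L.blocks[k]! do
      if blk.npts == 0 then
        match dat[blk.ri]! with
        | none => pure ()
        | some (kb, Gi) =>
          for t in [0:blk.masks.size] do
            let i := L.offK[k]! + blk.boff + t
            out := out.set! i (colLamFast L kb Gi blk.ri k blk.masks[t]!)
  return out

/-- reduced restriction of an untwisted class `x` (identity-sector component) to each rep, as arrays [folklore] -/
def restrictedForms (x : Ext) : Array (Array (Nat × Rat)) :=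
  Mo.reps.map (fun r => ((Mo.sec[r]!).reduce (restrictTo x Mo.sec[r]!)).toList.toArray)

/-- (plumbing) [cite: FantechiGoettsche2003, §3 (Thm. 3.10, the ring structure; genus/obstruction rule)] -/
def wedgeTable (L : Layout) (x : Ext) (dx : Nat) : Array SpVec := Id.run do
  let Ntot := L.offK[L.offK.size - 1]! + L.sizeK[L.sizeK.size - 1]!
  let Xr := Mo.restrictedForms x
  let mut out : Array SpVec := Array.replicate Ntot []
  for k in [0:L.blocks.size] do
    for blk in L.blocks[k]! do
      if blk.npts == 0 then
        for t in [0:blk.masks.size] do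
          let i := L.offK[k]! + blk.boff + t
          out := out.set! i (colWedgeFast L Xr[blk.ri]! blk.ri (k + dx) blk.masks[t]!)
  return out

/-- fast untwisted-generator column function (on-demand, for memoisation) [cite: FantechiGoettsche2003, §3 (Thm. 3.10, the ring structure; genus/obstruction rule)] -/
def colUntwFast (L : Layout) (Xr : Array (Array (Nat × Rat))) (dx : Nat) (i : Nat) : SpVec :=
  let (k, ri, mask) := L.decode i
  if mask ≥ 2^32 then [] else colWedgeFast L Xr[ri]! ri (k + dx) mask

/-- data for fast δ-type (twisted generator) columns: for each source rep position `ri`, the list of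
contributing (g ∈ supp X, x_g, h, conjugator index for h) with target rep determined by g h [cite: FantechiGoettsche2003, §3 (Thm. 3.10, the ring structure; genus/obstruction rule)] -/
def twistData (X : Cls) (ri : Nat) : Array (Nat × Ext × Nat × Nat) := Id.run do
  let r := Mo.reps[ri]!
  let mut out : Array (Nat × Ext × Nat × Nat) := #[]
  for (g, xg) in X.toList do
    for k in Mo.reps do
      let h := Mo.comp[Mo.inv[g]!]![k]!
      if Mo.repOf[h]! == r then
        out := out.push (g, xg, h, Mo.conj[h]!)
  return out

/-- fast twisted-generator column at a non-point index: Σ over contributing (g, h):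
`reduce_k (sectorProduct g x_g h (σ_h)_*(e_mask))`, encoded [cite: FantechiGoettsche2003, §3 (Thm. 3.10, the ring structure; genus/obstruction rule)] -/
def colTwFast (L : Layout) (TD : Array (Array (Nat × Ext × Nat × Nat))) (Xfull : Cls) (i : Nat) : SpVec :=
  let (_, ri, mask) := L.decode i
  let r := Mo.reps[ri]!
  if mask ≥ 2^32 then
    -- point p_y: (1/|pts|) · (X ⋆ u)
    let u : Cls := Cls.mk.addComp r Ext.one
    let z := Mo.productReps Xfull (Mo.extend u)
    (Mo.encodeCls L z).map (fun p => (p.1, p.2 / ((Mo.m ^ 4 : Nat) : Rat)))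
  else Id.run do
    let y := Ext.single mask 1
    let mut acc : Cls := Cls.mk
    for (g, xg, h, s) in TD[ri]! do
      let (_, yh) := Mo.push s r y
      let (gh, z) := Mo.sectorProduct g xg h yh
      acc := acc.addComp gh z
    return Mo.encodeCls L acc


end Model

end Literature.Computation.KummerOrbifold
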